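import Literature.AlgebraicTopology.FundamentalGroup.CellAttachment
import Literature.AlgebraicTopology.Homotopy.StrongDeformationRetract
import Mathlib.Analysis.Normed.Group.AddCircle
import Mathlib.Analysis.Convex.PathConnected
import HarnessLib

/-!
# Slit tori: the open cover of the once-punctured torus used for van Kampen

Topic `Literature/AlgebraicTopology/FundamentalGroup`.  For the real torus `T = (ℝ/ℤ)^ι` (the tree's
model `ι → AddCircle 1` of `PuncturedTorusSquareWord.lean` / `RealTorus.lean`; for two indices this is,
as a space, the tree's `ComplexTorus`) and a point `x₀ ∈ T`, the punctured torus `T ∖ {x₀}` is covered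
(when `ι` has two elements) by the open SLIT TORI `{p | p j ≠ x₀ j}`; this file proves the three
topological inputs of the van Kampen computation `π₁(T ∖ {x₀}) ≅ F₂` (A. Hatcher, *Algebraic Topology*
(2002), §1.2 Example 1.22 with Thm. 1.20), carried out in `PuncturedTorusFundamentalGroup.lean`:

* `isStrongDeformationRetractOf_coordSlide` — the slit torus `{p | p j ≠ x₀ j}` strong-deformation-
  retracts onto the circle (subtorus) `{p | p j = x₀ j + ½}` by SLIDING the `j`-th coordinate,
  `H_t(p) = p - t·z(p)·e_j` with `z(p) ∈ (-½, ½)` the lift of `p j - x₀ j - ½` (continuous off the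
  slit `p j = x₀ j`);
* `isPathConnected_coordNe` — the slit torus is path connected (a product of circles and one
  punctured circle, `isPathConnected_compl_singleton_addCircle`);
* `isSimplyConnected_forall_ne` — the open square `{p | ∀ i, p i ≠ x₀ i}` is simply connected: it
  contracts onto its centre `(x₀ i + ½)ᵢ` by sliding all coordinates (the tree's
  `isSimplyConnected_iff_of_deformation`).

Any index type `ι`; proof-only, no definitions.  Helpers: `coe_ne_half_of_abs_lt`, `half_ne_zero`.

## References
* A. Hatcher, *Algebraic Topology*, CUP (2002), §1.1 Thm. 1.7, Prop. 1.17; §1.2 Thm. 1.20,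
  Example 1.22 (p. 51). [HatcherAT2002]
-/

noncomputable section

open Set Function Metric Filter
open scoped Topology unitInterval

namespace Literature.AlgebraicTopology.FundamentalGroup

namespace PuncturedTorus

variable {ι : Type*}

/-! ### §1 Two facts about `ℝ/ℤ` -/

/-- A real number of absolute value `< ½` is not `½ (mod 1)`. [cite: HatcherAT2002, §1.2 p. 51] -/
theorem coe_ne_half_of_abs_lt {s : ℝ} (hs : |s| < 2⁻¹) :
    (s : AddCircle (1 : ℝ)) ≠ ((2⁻¹ : ℝ) : AddCircle (1 : ℝ)) := by
  intro h
  have hs' : s ∈ Ioc (-2⁻¹ : ℝ) (-2⁻¹ + 1) := by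
    constructor <;> [linarith [(abs_lt.1 hs).1]; linarith [(abs_lt.1 hs).2]]
  have hh : (2⁻¹ : ℝ) ∈ Ioc (-2⁻¹ : ℝ) (-2⁻¹ + 1) := by constructor <;> norm_num
  have := (AddCircle.coe_eq_coe_iff_of_mem_Ioc hs' hh).1 h
  rw [this, abs_of_pos (by norm_num : (0 : ℝ) < 2⁻¹)] at hs
  exact lt_irrefl _ hs

/-- `½ ≠ 0` in `ℝ/ℤ`. [cite: HatcherAT2002, §1.2 p. 51] -/
theorem half_ne_zero : ((2⁻¹ : ℝ) : AddCircle (1 : ℝ)) ≠ 0 := by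
  intro h
  obtain ⟨n, hn⟩ := (AddCircle.coe_eq_zero_iff (1 : ℝ)).1 h
  rw [zsmul_eq_mul, mul_one] at hn
  have h1 : (2 : ℝ) * n = 1 := by rw [hn]; norm_num
  have h2 : (2 : ℤ) * n = 1 := by exact_mod_cast h1
  omega

/-- **`ℝ/ℤ` minus a point is path connected** (image of an open interval).
[cite: HatcherAT2002, §1.1 Thm. 1.7 (the covering `ℝ → S¹`)] -/
theorem isPathConnected_compl_singleton_addCircle (y : AddCircle (1 : ℝ)) :
    IsPathConnected ({y}ᶜ : Set (AddCircle (1 : ℝ))) := by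
  have himage : (fun s : ℝ ↦ y + (s : AddCircle (1 : ℝ))) '' Ioo (0 : ℝ) 1 = {y}ᶜ := by
    ext w
    constructor
    · rintro ⟨s, hs, rfl⟩ h
      have h0 : ((s : ℝ) : AddCircle (1 : ℝ)) = 0 := by simpa using h
      obtain ⟨n, hn⟩ := (AddCircle.coe_eq_zero_iff (1 : ℝ)).1 h0
      rw [zsmul_eq_mul, mul_one] at hn
      have h1 : (0 : ℤ) < n := by exact_mod_cast (hn ▸ hs.1 : (0 : ℝ) < n)
      have h2 : n < (1 : ℤ) := by exact_mod_cast (hn ▸ hs.2 : (n : ℝ) < 1)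
      omega
    · intro hw
      refine ⟨(AddCircle.equivIco (1 : ℝ) 0 (w - y) : ℝ), ?_, ?_⟩
      · have hmem := (AddCircle.equivIco (1 : ℝ) 0 (w - y)).2
        refine ⟨lt_of_le_of_ne hmem.1 fun h0 ↦ hw ?_, by simpa using hmem.2⟩
        have : (((AddCircle.equivIco (1 : ℝ) 0 (w - y) : ℝ)) : AddCircle (1 : ℝ)) = w - y :=
          AddCircle.coe_equivIco
        rw [← h0, AddCircle.coe_zero] at this
        exact (sub_eq_zero.1 this.symm)
      · change y + (((AddCircle.equivIco (1 : ℝ) 0 (w - y) : ℝ)) : AddCircle (1 : ℝ)) = w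
        rw [AddCircle.coe_equivIco]; abel
  rw [← himage]
  exact ((convex_Ioo (0 : ℝ) 1).isPathConnected (nonempty_Ioo.2 one_pos)).image'
    ((continuous_const.add (AddCircle.continuous_mk' (1 : ℝ))).continuousOn)

/-! ### §2 Sliding one coordinate: `{p | p j ≠ x₀ j}` retracts onto `{p | p j = x₀ j + ½}` -/

/-- **The slit torus `{p | p j ≠ x₀ j}` deformation retracts onto the circle `{p | p j = x₀ j + ½}`**
by sliding the `j`-th coordinate: `H_t(p) = p - t·z(p)·e_j` with `z(p) ∈ (-½, ½)` the lift of
`p j - x₀ j - ½` (continuous off `p j = x₀ j`). [cite: HatcherAT2002, Prop. 1.17; §1.2 Example 1.22] -/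
theorem isStrongDeformationRetractOf_coordSlide [DecidableEq ι] (x₀ : ι → AddCircle (1 : ℝ)) (j : ι) :
    Homotopy.IsStrongDeformationRetractOf
      {p : ι → AddCircle (1 : ℝ) | p j - x₀ j = ((2⁻¹ : ℝ) : AddCircle (1 : ℝ))}
      {p : ι → AddCircle (1 : ℝ) | p j ≠ x₀ j} := by
  set z : (ι → AddCircle (1 : ℝ)) → ℝ :=
    fun p ↦ (AddCircle.equivIoc (1 : ℝ) (-2⁻¹) (p j - x₀ j - ((2⁻¹ : ℝ) : AddCircle (1 : ℝ))) : ℝ)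
    with hz_def
  set H : ℝ → (ι → AddCircle (1 : ℝ)) → (ι → AddCircle (1 : ℝ)) :=
    fun t p i ↦ if i = j then p j + (((-t * z p : ℝ)) : AddCircle (1 : ℝ)) else p i with hH_def
  have hz_coe : ∀ p, ((z p : ℝ) : AddCircle (1 : ℝ)) = p j - x₀ j - ((2⁻¹ : ℝ) : AddCircle (1 : ℝ)) :=
    fun p ↦ AddCircle.coe_equivIoc
  have hz_mem : ∀ p, z p ∈ Ioc (-2⁻¹ : ℝ) (-2⁻¹ + 1) := fun p ↦ (AddCircle.equivIoc _ _ _).2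
  -- off the slit, the lift avoids the end point `½`
  have hz_lt : ∀ p : ι → AddCircle (1 : ℝ), p j ≠ x₀ j → |z p| < 2⁻¹ := by
    intro p hp
    have hne : z p ≠ 2⁻¹ := by
      intro h
      apply hp
      have := hz_coe p
      rw [h] at this
      -- `½ = p j - x₀ j - ½`, so `p j - x₀ j = 1 = 0`
      have h2 : p j - x₀ j = ((2⁻¹ : ℝ) : AddCircle (1 : ℝ)) + ((2⁻¹ : ℝ) : AddCircle (1 : ℝ)) :=
        (eq_sub_iff_add_eq.1 this).symm
      rw [← AddCircle.coe_add, show (2⁻¹ : ℝ) + 2⁻¹ = 1 by norm_num, AddCircle.coe_period] at h2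
      exact sub_eq_zero.1 h2
    rw [abs_lt]
    exact ⟨by linarith [(hz_mem p).1], lt_of_le_of_ne (by linarith [(hz_mem p).2]) hne⟩
  have hHj : ∀ t p, H t p j = p j + (((-t * z p : ℝ)) : AddCircle (1 : ℝ)) := by
    intro t p; simp [hH_def]
  have hHi : ∀ t p i, i ≠ j → H t p i = p i := by
    intro t p i hi; simp [hH_def, hi]
  -- the `j`-th coordinate of `H t p` relative to the circle: `(1 - t) z p`
  have hHj' : ∀ t p, H t p j - x₀ j - ((2⁻¹ : ℝ) : AddCircle (1 : ℝ)) =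
      ((((1 - t) * z p : ℝ)) : AddCircle (1 : ℝ)) := by
    intro t p
    rw [hHj, show (1 - t) * z p = z p + -t * z p by ring, AddCircle.coe_add, hz_coe]
    abel
  refine Homotopy.IsStrongDeformationRetractOf.of_continuousOn H ?_ ?_ ?_ ?_ ?_
  · -- continuity on `[0, 1] × {p | p j ≠ x₀ j}`
    have hz : ContinuousOn (fun q : ℝ × (ι → AddCircle (1 : ℝ)) ↦ z q.2)
        (Icc (0 : ℝ) 1 ×ˢ {p : ι → AddCircle (1 : ℝ) | p j ≠ x₀ j}) := by
      intro q hq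
      have h1 : ContinuousAt (fun p : ι → AddCircle (1 : ℝ) ↦
          p j - x₀ j - ((2⁻¹ : ℝ) : AddCircle (1 : ℝ))) q.2 :=
        (((continuous_apply j).sub continuous_const).sub continuous_const).continuousAt
      have h2 : ContinuousAt (AddCircle.equivIoc (1 : ℝ) (-2⁻¹))
          (q.2 j - x₀ j - ((2⁻¹ : ℝ) : AddCircle (1 : ℝ))) := by
        refine AddCircle.continuousAt_equivIoc (p := (1 : ℝ)) (a := (-2⁻¹ : ℝ)) ?_
        intro h
        apply hq.2
        have h' : q.2 j - x₀ j = ((2⁻¹ : ℝ) : AddCircle (1 : ℝ)) + ((-2⁻¹ : ℝ) : AddCircle (1 : ℝ)) := by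
          rw [← h]; abel
        rw [← AddCircle.coe_add, show (2⁻¹ : ℝ) + -2⁻¹ = 0 by norm_num, AddCircle.coe_zero] at h'
        exact sub_eq_zero.1 h'
      have h3 : ContinuousAt (fun p : ι → AddCircle (1 : ℝ) ↦
          AddCircle.equivIoc (1 : ℝ) (-2⁻¹) (p j - x₀ j - ((2⁻¹ : ℝ) : AddCircle (1 : ℝ)))) q.2 :=
        ContinuousAt.comp (g := AddCircle.equivIoc (1 : ℝ) (-2⁻¹))
          (f := fun p : ι → AddCircle (1 : ℝ) ↦ p j - x₀ j - ((2⁻¹ : ℝ) : AddCircle (1 : ℝ))) h2 h1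
      exact ((continuous_subtype_val.continuousAt.comp h3).comp_continuousWithinAt
        continuous_snd.continuousWithinAt)
    refine continuousOn_pi.2 fun i ↦ ?_
    by_cases hi : i = j
    · subst hi
      simp only [hH_def, if_true]
      exact ((continuous_apply i).comp continuous_snd).continuousOn.add
        ((AddCircle.continuous_mk' (1 : ℝ)).comp_continuousOn
          ((continuous_fst.neg.continuousOn).mul hz))
    · simp only [hH_def, hi, if_false]
      exact ((continuous_apply i).comp continuous_snd).continuousOn
  · -- `H t` preserves the slit torus
    intro t ht p hp hmem
    apply coe_ne_half_of_abs_lt (s := (1 - t) * z p)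
    · rw [abs_mul]
      calc |1 - t| * |z p| ≤ 1 * |z p| := by
            refine mul_le_mul_of_nonneg_right ?_ (abs_nonneg _)
            rw [abs_le]; constructor <;> linarith [ht.1, ht.2]
        _ < 2⁻¹ := by rw [one_mul]; exact hz_lt p hp
    · rw [← hHj' t p, (show H t p j = x₀ j from hmem), sub_self, zero_sub, ← AddCircle.coe_neg,
        ← AddCircle.coe_add_period (1 : ℝ) (-2⁻¹ : ℝ)]
      norm_num
  · -- `H 0 = id`
    intro p _
    funext i
    by_cases hi : i = j
    · subst hi; rw [hHj]; simp
    · exact hHi 0 p i hi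
  · -- `H 1` lands on the circle
    intro p _
    show H 1 p j - x₀ j = _
    have := hHj' 1 p
    rw [sub_self, zero_mul, AddCircle.coe_zero, sub_eq_zero] at this
    exact this
  · -- the circle is fixed
    intro t _ p _ hpC
    have hz0 : z p = 0 := by
      have h0 : p j - x₀ j - ((2⁻¹ : ℝ) : AddCircle (1 : ℝ)) = ((0 : ℝ) : AddCircle (1 : ℝ)) := by
        rw [(show p j - x₀ j = _ from hpC), sub_self, AddCircle.coe_zero]
      simp only [hz_def, h0]
      exact AddCircle.equivIoc_coe_of_mem (by constructor <;> norm_num)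
    funext i
    by_cases hi : i = j
    · subst hi; rw [hHj, hz0]; simp
    · exact hHi t p i hi

/-- **The slit torus is path connected** (a product of circles and one punctured circle).
[cite: HatcherAT2002, §1.2 Example 1.22] -/
theorem isPathConnected_coordNe [DecidableEq ι] (x₀ : ι → AddCircle (1 : ℝ)) (j : ι) :
    IsPathConnected {p : ι → AddCircle (1 : ℝ) | p j ≠ x₀ j} := by
  have hpi : {p : ι → AddCircle (1 : ℝ) | p j ≠ x₀ j} =
      Set.univ.pi fun i ↦ if i = j then {x₀ i}ᶜ else univ := by
    ext p
    simp only [mem_setOf_eq, mem_univ_pi]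
    constructor
    · intro h i
      by_cases hi : i = j
      · subst hi; simpa using h
      · simp [hi]
    · intro h
      simpa using h j
  rw [hpi]
  refine IsPathConnected.pi fun i ↦ ?_
  by_cases hi : i = j
  · subst hi; simpa using isPathConnected_compl_singleton_addCircle (x₀ i)
  · simpa [hi] using isPathConnected_univ (X := AddCircle (1 : ℝ))

/-! ### §3 The open square `{p | ∀ i, p i ≠ x₀ i}` is simply connected -/

/-- **The open square `{p | ∀ i, p i ≠ x₀ i}` contracts onto its centre `(x₀ i + ½)ᵢ`**
(slide every coordinate), so it is simply connected. [cite: HatcherAT2002, §1.2 Example 1.22; Thm. 1.20] -/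
theorem isSimplyConnected_forall_ne (x₀ : ι → AddCircle (1 : ℝ)) :
    IsSimplyConnected {p : ι → AddCircle (1 : ℝ) | ∀ i, p i ≠ x₀ i} := by
  set w₀ : ι → AddCircle (1 : ℝ) := fun i ↦ x₀ i + ((2⁻¹ : ℝ) : AddCircle (1 : ℝ)) with hw₀
  set S : Set (ι → AddCircle (1 : ℝ)) := {p | ∀ i, p i ≠ x₀ i} with hS
  have hw₀S : w₀ ∈ S := fun i h ↦ half_ne_zero (by simpa [hw₀] using h)
  -- contract `S` onto `{w₀}` by composing the coordinate slides? — directly: all coordinates at once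
  set z : ι → (ι → AddCircle (1 : ℝ)) → ℝ :=
    fun i p ↦ (AddCircle.equivIoc (1 : ℝ) (-2⁻¹) (p i - x₀ i - ((2⁻¹ : ℝ) : AddCircle (1 : ℝ))) : ℝ)
    with hz_def
  have hz_coe : ∀ i p, ((z i p : ℝ) : AddCircle (1 : ℝ)) = p i - x₀ i - ((2⁻¹ : ℝ) : AddCircle (1 : ℝ)) :=
    fun i p ↦ AddCircle.coe_equivIoc
  have hz_mem : ∀ i p, z i p ∈ Ioc (-2⁻¹ : ℝ) (-2⁻¹ + 1) := fun i p ↦ (AddCircle.equivIoc _ _ _).2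
  have hz_lt : ∀ i (p : ι → AddCircle (1 : ℝ)), p i ≠ x₀ i → |z i p| < 2⁻¹ := by
    intro i p hp
    have hne : z i p ≠ 2⁻¹ := by
      intro h
      apply hp
      have := hz_coe i p
      rw [h] at this
      have h2 : p i - x₀ i = ((2⁻¹ : ℝ) : AddCircle (1 : ℝ)) + ((2⁻¹ : ℝ) : AddCircle (1 : ℝ)) :=
        (eq_sub_iff_add_eq.1 this).symm
      rw [← AddCircle.coe_add, show (2⁻¹ : ℝ) + 2⁻¹ = 1 by norm_num, AddCircle.coe_period] at h2
      exact sub_eq_zero.1 h2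
    rw [abs_lt]
    exact ⟨by linarith [(hz_mem i p).1], lt_of_le_of_ne (by linarith [(hz_mem i p).2]) hne⟩
  have hz_cont : ∀ i (p : ι → AddCircle (1 : ℝ)), p i ≠ x₀ i → ContinuousAt (z i) p := by
    intro i p hp
    have h1 : ContinuousAt (fun p : ι → AddCircle (1 : ℝ) ↦
        p i - x₀ i - ((2⁻¹ : ℝ) : AddCircle (1 : ℝ))) p :=
      (((continuous_apply i).sub continuous_const).sub continuous_const).continuousAt
    have h2 : ContinuousAt (AddCircle.equivIoc (1 : ℝ) (-2⁻¹))
        (p i - x₀ i - ((2⁻¹ : ℝ) : AddCircle (1 : ℝ))) := by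
      refine AddCircle.continuousAt_equivIoc (p := (1 : ℝ)) (a := (-2⁻¹ : ℝ)) ?_
      intro h
      apply hp
      have h' : p i - x₀ i = ((2⁻¹ : ℝ) : AddCircle (1 : ℝ)) + ((-2⁻¹ : ℝ) : AddCircle (1 : ℝ)) := by
        rw [← h]; abel
      rw [← AddCircle.coe_add, show (2⁻¹ : ℝ) + -2⁻¹ = 0 by norm_num, AddCircle.coe_zero] at h'
      exact sub_eq_zero.1 h'
    exact continuous_subtype_val.continuousAt.comp
      (ContinuousAt.comp (g := AddCircle.equivIoc (1 : ℝ) (-2⁻¹))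
        (f := fun p : ι → AddCircle (1 : ℝ) ↦ p i - x₀ i - ((2⁻¹ : ℝ) : AddCircle (1 : ℝ))) h2 h1)
  have hret : Homotopy.IsStrongDeformationRetractOf {w₀} S := by
    set H : ℝ → (ι → AddCircle (1 : ℝ)) → (ι → AddCircle (1 : ℝ)) :=
      fun t p i ↦ p i + (((-t * z i p : ℝ)) : AddCircle (1 : ℝ)) with hH_def
    have hH' : ∀ t p i, H t p i - x₀ i - ((2⁻¹ : ℝ) : AddCircle (1 : ℝ)) =
        ((((1 - t) * z i p : ℝ)) : AddCircle (1 : ℝ)) := by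
      intro t p i
      simp only [hH_def]
      rw [show (1 - t) * z i p = z i p + -t * z i p by ring, AddCircle.coe_add, hz_coe]
      abel
    refine Homotopy.IsStrongDeformationRetractOf.of_continuousOn H ?_ ?_ ?_ ?_ ?_
    · refine continuousOn_pi.2 fun i ↦ ?_
      simp only [hH_def]
      refine ((continuous_apply i).comp continuous_snd).continuousOn.add
        ((AddCircle.continuous_mk' (1 : ℝ)).comp_continuousOn
          ((continuous_fst.neg.continuousOn).mul fun q hq ↦ ?_))
      exact (hz_cont i q.2 (hq.2 i)).comp_continuousWithinAt continuous_snd.continuousWithinAt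
    · intro t ht p hp i hmem
      apply coe_ne_half_of_abs_lt (s := (1 - t) * z i p)
      · rw [abs_mul]
        calc |1 - t| * |z i p| ≤ 1 * |z i p| := by
              refine mul_le_mul_of_nonneg_right ?_ (abs_nonneg _)
              rw [abs_le]; constructor <;> linarith [ht.1, ht.2]
          _ < 2⁻¹ := by rw [one_mul]; exact hz_lt i p (hp i)
      · rw [← hH' t p i, hmem, sub_self, zero_sub, ← AddCircle.coe_neg,
          ← AddCircle.coe_add_period (1 : ℝ) (-2⁻¹ : ℝ)]
        norm_num
    · intro p _; funext i; simp [hH_def]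
    · intro p _
      show H 1 p = w₀
      funext i
      have := hH' 1 p i
      rw [sub_self, zero_mul, AddCircle.coe_zero, sub_eq_zero, sub_eq_iff_eq_add] at this
      rw [this, hw₀]; exact add_comm _ _
    · intro t _ p _ hp
      rw [mem_singleton_iff] at hp
      subst hp
      funext i
      have hz0 : z i w₀ = 0 := by
        have h0 : w₀ i - x₀ i - ((2⁻¹ : ℝ) : AddCircle (1 : ℝ)) = ((0 : ℝ) : AddCircle (1 : ℝ)) := by
          simp [hw₀]
        simp only [hz_def, h0]
        exact AddCircle.equivIoc_coe_of_mem (by constructor <;> norm_num)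
      simp [hH_def, hz0]
  obtain ⟨H, h0, h1, hfix⟩ := hret
  have hsub : ({w₀} : Set (ι → AddCircle (1 : ℝ))) ⊆ S := singleton_subset_iff.2 hw₀S
  rw [isSimplyConnected_iff_of_deformation hsub H h0 h1 hfix]
  -- a point is simply connected
  haveI : Unique (({w₀} : Set (ι → AddCircle (1 : ℝ))) : Type _) := Set.uniqueSingleton w₀
  show SimplyConnectedSpace _
  infer_instance

end PuncturedTorus

end Literature.AlgebraicTopology.FundamentalGroup

end
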